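import Mathlib
import Summits.KontsevichZagierPeriods.KontsevichZagierPeriods.Theorems.SoloInformedBoxChart
import Summits.KontsevichZagierPeriods.KontsevichZagierPeriods.Theorems.SoloInformedBoxSym
import Summits.KontsevichZagierPeriods.KontsevichZagierPeriods.Theorems.SoloInformedHesseMove
import Summits.KontsevichZagierPeriods.KontsevichZagierPeriods.Theorems.SoloInformedHesseChambers
import Literature.NumberTheory.Transcendental.KZCalculus
import Literature.NumberTheory.Transcendental.KZDirichletScaling
import Literature.NumberTheory.Transcendental.KZDirichletPeeling
import Literature.NumberTheory.Transcendental.KZGaussMultiplicationChain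
import Literature.NumberTheory.Transcendental.KZSubcalculusInvariants
import Literature.NumberTheory.Transcendental.KZRelationsLE
import HarnessLib
import HarnessLib.Audit

/-!
# SoloInformed — Gauss triplication by the moves, IX: `MultiplicationAccessible (2, s)` and the
pure-Beta triplication formula in `P`, unconditionally

**Theorem** (`soloInformed_multiplicationAccessible_two`). For every rational `s > 0`, the cube Beta
representation `[(0,1)², x^{-2/3}(1-x)^{s-1} y^{-1/3}(1-y)^{s-1}]` is `KZ.Equivalent` to the big
simplex representation `[S₂, (σ₀σ₁(3−σ₀−σ₁))^{s−1}]` — the instance `(m, s) = (2, s)` of the route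
item `MultiplicationAccessible`, by an explicit chain of eleven moves of rules (1), (2) through
the common target `T = [B₃′, 3κ·F^{s−1}]`, `F = xy(1−x−y)`, `κ = 3^{3s−1}`:

* box side (`SoloInformedBoxCube/Sym/Chart`): cube roots, diagonal split, swap, integrand addition,
  then the rational chart `Φ : H₁ → B₃′` (`F∘Φ = c/27`, `|det DΦ| = (X+Y)/3`);
* simplex side (`SoloInformedHesseTangential/Rho/Chart/Move/Chambers`): the scaling `σ = 3u`
  (`KZ.bigSimplex_equivalent_constMul_dirichlet`), the six Weyl chambers, and the tangential chart
  `Ψ : C₀ → B₃′` of the Hesse pencil (`F∘Ψ = F`, `|det DΨ| = 2`).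

No `π` appears anywhere: the two sides meet on a common algebraic region, not on a common value.
**Corollary** (`soloInformed_gauss_triplication_toFormalPeriod`): Gauss's triplication formula
`B(⅓,s)·B(⅔,s) = 3^{3s−1}·B(s,s)·B(s,2s)` holds in the formal period ring `P`
(`KZ.gaussMultiplication_toFormalPeriod 2 s`, now hypothesis-free).

Residency `solo-KontsevichZagierPeriods-informed` (s71); paper §7 (c6)(x).
References: Kontsevich–Zagier, *Periods* (2001), §1.2; Andrews–Askey–Roy (1999), Thm 1.5.2.
-/

noncomputable section

open MeasureTheory Set Filter
namespace Summit.KontsevichZagierPeriods.KontsevichZagierPeriods.Theorems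

open Literature.NumberTheory.Transcendental Literature.NumberTheory.Transcendental.KZ
open Literature.ModelTheory.ExponentialFields

/-! ### Rule (2) along `Φ` -/

/-- **Rule (2) along the box-to-pencil chart**:
`[H₁, b·(c/27)^e·(X+Y)/3] ∼ [B₃′, b·F^e]`. [this work] -/
theorem soloInformed_boxMove (b e : ℝ) (U T : IntegralRep 2) (hUd : U.domain = soloInformedH1)
    (hUi : EqOn U.integrand (fun X => b * (soloInformedBoxC X / 27) ^ e * ((X 0 + X 1) / 3)) U.domain)
    (hTd : T.domain = soloInformedB3) (hTi : EqOn T.integrand (soloInformedHesseKernel b e) T.domain) :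
    Equivalent U T := by
  obtain ⟨hsa, hderiv, hinj, himage, hdet⟩ := soloInformed_boxChart
  refine changeOfVariablesRel_subset_relations
    ⟨2, U, T, soloInformedPhi, soloInformedPhiD, by rw [hUd]; exact hsa,
      fun X hX => (hderiv X (by rw [hUd] at hX; exact hX)).hasFDerivWithinAt,
      by rw [hUd]; exact hinj, by rw [hUd, hTd, himage], fun X hX => ?_, rfl⟩
  have hX1 : X ∈ soloInformedH1 := by rw [hUd] at hX; exact hX
  have hTX : soloInformedPhi X ∈ T.domain := by
    rw [hTd, ← himage]; exact mem_image_of_mem _ hX1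
  rw [hUi hX, hTi hTX, hdet X hX1]
  obtain ⟨hx, hxy, -⟩ := hX1
  simp only [soloInformedHesseKernel, soloInformedPhi_zero, soloInformedPhi_one]
  rw [soloInformed_hesseF_phi hx.ne' (by linarith) (by intro h; linarith), soloInformedBoxC]

/-! ### Constants and the pinned integrands -/

/-- `3^{3s−1} = 9 · 27^{s−1}`. [folklore] -/
theorem soloInformed_gaussConst_two (s : ℝ) : (3:ℝ) ^ (3 * s - 1) = 9 * (27:ℝ) ^ (s - 1) := by
  rw [show (27:ℝ) = (3:ℝ) ^ (3:ℝ) by norm_num, ← Real.rpow_mul (by norm_num),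
    show (9:ℝ) = (3:ℝ) ^ (2:ℝ) by norm_num, ← Real.rpow_add (by norm_num)]
  congr 1
  ring

/-- The cube Beta integrand, verbatim as pinned in `KZ.gaussMultiplication_toFormalPeriod 2 s`, is
`x^{-2/3}(1-x)^{e}·y^{-1/3}(1-y)^{e}`. [this work] -/
theorem soloInformed_cubeBeta_eq (e : ℝ) (x : Fin 2 → ℝ) :
    (∏ i : Fin 2, x i ^ ((((i:ℕ):ℝ) + 1) / (((2:ℕ):ℝ) + 1) - 1) * (1 - x i) ^ e) =
      soloInformedCubeBeta e x := by
  rw [Fin.prod_univ_two, soloInformedCubeBeta]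
  have a : ((((0 : Fin 2):ℕ):ℝ) + 1) / (((2:ℕ):ℝ) + 1) - 1 = -(2 / 3 : ℝ) := by norm_num
  have b : ((((1 : Fin 2):ℕ):ℝ) + 1) / (((2:ℕ):ℝ) + 1) - 1 = -(1 / 3 : ℝ) := by norm_num
  rw [a, b]

/-- The symmetrised box integrand `9(X+Y)c^{s−1}` is `3κ·(c/27)^{s−1}·(X+Y)/3`, `κ = 3^{3s−1}`.
[this work] -/
theorem soloInformed_boxU_eq (s : ℚ) {X : Fin 2 → ℝ} (hX : X ∈ soloInformedUnitBox) :
    soloInformedBoxU ((s:ℝ) - 1) X =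
      3 * ((((2:ℕ):ℝ) + 1) ^ ((((2:ℕ):ℝ) + 1) * (s:ℝ) - 1)) *
        (soloInformedBoxC X / 27) ^ ((s:ℝ) - 1) * ((X 0 + X 1) / 3) := by
  have hc := soloInformed_boxC_pos hX
  have h3 : (((2:ℕ):ℝ) + 1) = 3 := by norm_num
  rw [h3, soloInformed_gaussConst_two, Real.div_rpow hc.le (by norm_num), soloInformedBoxU]
  have h27 : (0:ℝ) < (27:ℝ) ^ ((s:ℝ) - 1) := Real.rpow_pos_of_pos (by norm_num) _
  field_simp

/-! ### The simplex side -/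

/-- **The simplex side.** Every big-simplex representation `[S₂, (σ₀σ₁(3−Σσ))^{s−1}]` is
equivalent to a representation `T` with `T.domain = B₃′` and `T.integrand = 3κ·F^{s−1}` on it
(`κ = 3^{3s−1}`): scaling, six chambers, tangential chart, rescaling. [this work] -/
theorem soloInformed_simplexSide (s : ℚ) (hs : 0 < s) (P : IntegralRep 2)
    (hPd : P.domain = {x | (∀ i, 0 < x i) ∧ ∑ i, x i < ((2:ℕ):ℝ) + 1})
    (hPi : EqOn P.integrand (fun x => ((∏ i, x i) * (((2:ℕ):ℝ) + 1 - ∑ i, x i)) ^ ((s:ℝ) - 1)) P.domain) :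
    ∃ T : IntegralRep 2, T.domain = soloInformedB3 ∧
      EqOn T.integrand (soloInformedHesseKernel (3 * ((((2:ℕ):ℝ) + 1) ^ ((((2:ℕ):ℝ) + 1) * (s:ℝ) - 1)))
        ((s:ℝ) - 1)) T.domain ∧ Equivalent P T := by
  have hκ := isAlgebraic_gaussMultConst 2 s
  obtain ⟨D, hDd, hDi⟩ := exists_dirichletRep s hs 2 s hs
  -- (1) the scaling σ = 3u
  have e1 : Equivalent P (D.constMul _ hκ) :=
    bigSimplex_equivalent_constMul_dirichlet 2 s P D hPd hPi hDd (fun u _ => by rw [hDi]) hκ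
  -- (2) the six chambers
  have hDd' : D.domain = soloInformedOpenSimplex := by rw [hDd]; rfl
  have hC0 : soloInformedC0 ⊆ D.domain := by
    rw [hDd]
    rintro z ⟨h0, h1, h2⟩
    refine ⟨fun i => ?_, by rw [Fin.sum_univ_two]; linarith⟩
    fin_cases i
    · exact h0
    · show 0 < z 1
      linarith
  have hDi' : EqOn D.integrand (fun w => (fun F : ℝ => F ^ ((s:ℝ) - 1)) (w 0 * w 1 * (1 - w 0 - w 1)))
      D.domain := by
    intro w hw
    rw [hDd] at hw
    obtain ⟨hpos, hsum⟩ := hw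
    have h0 := hpos 0
    have h1 := hpos 1
    rw [Fin.sum_univ_two] at hsum
    rw [hDi]
    simp only [Fin.prod_univ_two, Fin.sum_univ_two]
    rw [← Real.mul_rpow h0.le h1.le, ← Real.mul_rpow (mul_nonneg h0.le h1.le) (by linarith),
      show 1 - (w 0 + w 1) = 1 - w 0 - w 1 by ring]
  have e2 := soloInformed_chambers (fun F : ℝ => F ^ ((s:ℝ) - 1)) D hDd' hDi' hC0
  set A := D.restrict soloInformedC0 soloInformed_isSemialgebraic_C0 hC0 with hA
  -- (3) the tangential chart
  have hAd : A.domain = soloInformedC0 := rfl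
  have hAi : EqOn A.integrand (soloInformedHesseKernel 1 ((s:ℝ) - 1)) A.domain := by
    intro z hz
    show D.integrand z = _
    rw [hDi' (hC0 hz), soloInformedHesseKernel, one_mul]
  obtain ⟨T', hT'd, hT'i⟩ := soloInformed_exists_outerRep isAlgebraic_one s A hAd hAi
  have e3 : Equivalent A T' :=
    soloInformed_hesseMove 1 ((s:ℝ) - 1) A T' hAd hAi hT'd (fun w _ => by rw [hT'i])
  -- (4) rescaling by 6 and by κ
  have e4 := IntegralRep.of_constMul_nat_sub_nsmul_mem_relations T' 6
  have e5 : Equivalent D (T'.constMul ((6:ℕ):ℝ) (isAlgebraic_nat 6)) := by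
    have h : of D - of (T'.constMul ((6:ℕ):ℝ) (isAlgebraic_nat 6)) =
        (of D - 6 • of A) + 6 • (of A - of T') - (of (T'.constMul ((6:ℕ):ℝ) (isAlgebraic_nat 6)) - 6 • of T') := by
      abel
    show of D - of (T'.constMul ((6:ℕ):ℝ) (isAlgebraic_nat 6)) ∈ relations
    rw [h]
    exact relations.sub_mem (relations.add_mem e2 (relations.nsmul_mem e3 6)) e4
  refine ⟨(T'.constMul ((6:ℕ):ℝ) (isAlgebraic_nat 6)).constMul _ hκ, hT'd, fun w _ => ?_,
    e1.trans (Equivalent.constMul _ hκ e5)⟩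
  show _ * (((6:ℕ):ℝ) * T'.integrand w) = _
  rw [hT'i]
  simp only [soloInformedHesseKernel, Nat.cast_ofNat]
  ring

/-! ### The instance `(2, s)` of `MultiplicationAccessible` and Gauss triplication in `P` -/

/-- **`MultiplicationAccessible (2, s)`, unconditionally.** For every rational `s > 0`, every
representation pinned as the cube Beta representation
`[(0,1)², x^{-2/3}(1-x)^{s-1}·y^{-1/3}(1-y)^{s-1}]` is `KZ.Equivalent` to every representation
pinned as the big simplex `[S₂, (σ₀σ₁(3−σ₀−σ₁))^{s−1}]` — hypothesis `hM` of
`KZ.gaussMultiplication_toFormalPeriod 2 s`, by eleven explicit moves of rules (1), (2) through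
the common target `[B₃′, 3^{3s}·F^{s−1}]`. No `π`-cancellation is involved. [this work] -/
theorem soloInformed_multiplicationAccessible_two (s : ℚ) (hs : 0 < s) (r r' : IntegralRep 2)
    (hrd : r.domain = {x | ∀ i, x i ∈ Set.Ioo (0:ℝ) 1})
    (hri : EqOn r.integrand (fun x => ∏ i : Fin 2,
      (x i) ^ ((((i:ℕ):ℝ) + 1) / (((2:ℕ):ℝ) + 1) - 1) * (1 - x i) ^ ((s:ℝ) - 1)) r.domain)
    (hr'd : r'.domain = {x | (∀ i, 0 < x i) ∧ ∑ i, x i < ((2:ℕ):ℝ) + 1})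
    (hr'i : EqOn r'.integrand
      (fun x => ((∏ i, x i) * (((2:ℕ):ℝ) + 1 - ∑ i, x i)) ^ ((s:ℝ) - 1)) r'.domain) :
    Equivalent r r' := by
  obtain ⟨T, hTd, hTi, hPT⟩ := soloInformed_simplexSide s hs r' hr'd hr'i
  have hrd' : r.domain = soloInformedUnitBox := by rw [hrd]; rfl
  have hri' : EqOn r.integrand (soloInformedCubeBeta ((s:ℝ) - 1)) r.domain := fun x hx => by
    rw [hri hx]; exact soloInformed_cubeBeta_eq _ x
  obtain ⟨R, hRd, hRi⟩ := soloInformed_exists_cubeRootRep s r hrd' hri'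
  obtain ⟨U, hUd, hUi⟩ := soloInformed_exists_U s R hRd (fun X _ => by rw [hRi])
  have hrU : Equivalent r U := soloInformed_boxChain s r U hrd' hri' hUd (fun X _ => by rw [hUi])
  have hUT : Equivalent U T :=
    soloInformed_boxMove _ ((s:ℝ) - 1) U T hUd (fun X hX => by
      rw [hUi]
      exact soloInformed_boxU_eq s (soloInformed_H1_subset_box (by rw [hUd] at hX; exact hX))) hTd hTi
  exact (hrU.trans hUT).trans hPT.symm

/-- **Gauss's triplication formula in the formal period ring, unconditionally**:
`⟦β(⅓,s)⟧·⟦β(⅔,s)⟧ = ⟦[pt, 3^{3s−1}]⟧·⟦β(s,s)⟧·⟦β(s,2s)⟧` in `P` for every rational `s > 0`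
(`KZ.gaussMultiplication_toFormalPeriod 2 s` with its hypothesis `hM` discharged by
`soloInformed_multiplicationAccessible_two`). Value identity:
`B(⅓,s)B(⅔,s) = 3^{3s−1} B(s,s) B(s,2s)`. [this work] -/
theorem soloInformed_gauss_triplication_toFormalPeriod (s : ℚ) (hs : 0 < s)
    (x : Fin 2 → ℚ) (hx : ∀ i, x i = (((i : ℕ) : ℚ) + 1) / (((2:ℕ) : ℚ) + 1))
    (βL : Fin 2 → IntegralRep 1) (hβLd : ∀ i, (βL i).domain = {t | t 0 ∈ Set.Ioo (0:ℝ) 1})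
    (hβLi : ∀ i, Set.EqOn (βL i).integrand
      (fun t => (t 0) ^ (((x i : ℚ) : ℝ) - 1) * (1 - t 0) ^ ((s:ℝ) - 1)) (βL i).domain)
    (b : Fin 2 → ℚ) (hb : ∀ j, b j = (((j : ℕ) : ℚ) + 1) * s)
    (βR : Fin 2 → IntegralRep 1) (hβRd : ∀ j, (βR j).domain = {t | t 0 ∈ Set.Ioo (0:ℝ) 1})
    (hβRi : ∀ j, Set.EqOn (βR j).integrand
      (fun t => (t 0) ^ ((s:ℝ) - 1) * (1 - t 0) ^ (((b j : ℚ) : ℝ) - 1)) (βR j).domain)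
    (hκ : IsAlgebraic ℚ ((((2:ℕ):ℝ) + 1) ^ ((((2:ℕ):ℝ) + 1) * s - 1))) :
    ∏ i, toFormalPeriod (of (βL i)) =
      toFormalPeriod (of (IntegralRep.unit.constMul ((((2:ℕ):ℝ) + 1) ^ ((((2:ℕ):ℝ) + 1) * s - 1)) hκ)) *
        ∏ j, toFormalPeriod (of (βR j)) :=
  gaussMultiplication_toFormalPeriod 2 s hs (soloInformed_multiplicationAccessible_two s hs) x hx βL hβLd
    hβLi b hb βR hβRd hβRi hκ

end Summit.KontsevichZagierPeriods.KontsevichZagierPeriods.Theorems
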